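import Literature.NumberTheory.Automorphic.ArchEndoscopicChartOrbUnfoldLeaves      -- ★ p850744 (this seat): (α1) per-place leaves `exists_placeLeaves_archRH_mul_chartOrbH_eq_of_isHaarMeasure` (compact leaves explicit, per-place properness)
import Literature.NumberTheory.Automorphic.ArchRankOneOrbitalVolumeWallBound         -- (α4⁰) part 1 (this seat): `exists_nhds_norm_mul_measure_conj_endoBlock_mem_le` (the wall-place factor)
import HarnessLib

/-!
# THE NORMALISED CHART ORBITAL INTEGRAL `R_S(c) · chartOrbH νH S fH c` IS LOCALLY BOUNDED UP TO ALL THE WALLS — product positivity over the places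
# (Harish-Chandra's estimate `|D(γ)|^{1/2} |O_γ(f)| ≤ B` for `U(1,1)^{[L⁺:ℚ]} × U(1)^{[L⁺:ℚ]}`; Varadarajan 1989 §6.4 Thm 22, Bouaziz 1994 §3.1 (I₂), Shelstad 1979 §4)

Topic `NumberTheory/Automorphic`; namespace `Literature.NumberTheory.Automorphic.UnitaryGroup`.  THEOREMS ONLY (no `def`, no instance, no axiom, no `sorry`).  Cell `pub/hodgecm-mathlib`,
crux H413 (`stmt-HodgeConjecture-24833`), line LH3 (closer stub `stub_N9`, DIRECT ROAD), organ O-L3′ conjunct (ii) pay-down for GENERAL `fH` (LH3-plan (g3) RULINGS #7 (d) ∕ #11), stage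
(α4⁰) part 2∕3.  Author LH3-p01 (g4).  Count-neutral.

THE MATHEMATICS.  By ★ (α1), on `RegS S`
  `R_S(c) · chartOrbH νH S fH c = K₀ · E_S(c) · ∫ fH(eA⁻¹ (z_{w,1} γ_w(c_w) z_{w,2} z_{w,1}⁻¹)_w, b(c)) d(⊗_w Λ_w)(z)`,  `E_S(c) = Π_w E_w(c_w)`, `E_w = e^{x_w}` (`w ∈ S`), `1 − e^{i(θ_{w,2} − θ_{w,0})}` (`w ∉ S`).
PRODUCT POSITIVITY (**`norm_integral_pi_le_mul_prod_measure`**): the integrand is bounded by `‖fH‖_∞` and vanishes unless every `z_w` lies in `A_w(c) = {z_w : z_{w,1} γ_w(c_w) z_{w,2} z_{w,1}⁻¹ ∈ C_w}`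
(`C_w` the `w`-shadow of `supp fH` through `eA`), so `‖E_S(c) ∫ …‖ ≤ ‖fH‖_∞ · Π_w ‖E_w(c_w)‖ · Λ_w(A_w(c))` (`Measure.pi_pi`), and each weighted factor is bounded near `c₀`: at a split
place or a compact place regular at `c₀`, by the UNIFORM PROPERNESS of the leaf over a compact neighbourhood (★ (α1); **`measure_le_of_inter_subset_of_compl_null`**); at a compact place ON
THE WALL at `c₀`, the leaf is `(g ↦ (g,1))_* ν_w`, `Λ_w(A_w(c)) = ν_w{g : g γ_w(c) g⁻¹ ∈ C_w}`, and ★ part 1 `exists_nhds_norm_mul_measure_conj_endoBlock_mem_le` applies.  Head: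
**`exists_nhds_norm_archRH_mul_chartOrbH_le`**: `∀ c₀, ∃ U ∈ 𝓝 c₀, ∃ B, ∀ c ∈ U ∩ RegS S, ‖archRH S c · chartOrbH L νH S fH c‖ ≤ B` (continuous compactly supported `fH`, Haar `νH`).
HONEST LABEL: HC_CM is proved only modulo the 7 printed citations (2 remaining: hLiu418 = stmt-HodgeConjecture-24832, h413 = stmt-HodgeConjecture-24833) until rung 0 closes;
the order-zero core of (I₂) for general `fH`, folded into `stOrbFamH` by part 3.

## References
* [Varadarajan1989] V. S. Varadarajan, *An Introduction to Harmonic Analysis on Semisimple Lie Groups*, Cambridge Stud. Adv. Math. 16 (1989), §6.4 Lemma 21, Thm 22.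
* [Bouaziz1994IntegralesOrbitales] A. Bouaziz, *Intégrales orbitales sur les algèbres de Lie réductives*, Invent. Math. 115 (1994), §3.1 (I₂) p. 579.
* [Shelstad1979] D. Shelstad, *Characters and inner forms of a quasi-split group over ℝ*, Compositio Math. 39 (1979), §4 pp. 22–25.
* [Folland1995] G. B. Folland, *A Course in Abstract Harmonic Analysis* (1995), §2.6 (2.52).
-/

set_option autoImplicit false

noncomputable section

open MeasureTheory Measure Filter Topology Set Function NumberField NumberField.InfinitePlace Matrix Complex
open Literature.NumberTheory.Automorphic Literature.NumberTheory.Automorphic.UnitaryGroup Literature.NumberTheory.Automorphic.ArchCartan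
open scoped ContDiff Classical MatrixGroups Matrix ENNReal NNReal
open scoped Matrix.Norms.Operator

local notation3 "Φ₂[" L "]" => (Matrix.of fun i j : Fin 2 => if i.val + j.val + 1 = 2 then (1 : L) else 0)
local notation3 "Φ₁[" L "]" => (Matrix.of fun i j : Fin 1 => if i.val + j.val + 1 = 1 then (1 : L) else 0)
local notation3 "𝔸[" L "]" => ↥(arch (↥(maximalRealSubfield L)) L (IsCMField.complexConj L) 2 Φ₂[L])
local notation3 "𝔹[" L "]" => ↥(arch (↥(maximalRealSubfield L)) L (IsCMField.complexConj L) 1 Φ₁[L])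

namespace Literature.NumberTheory.Automorphic.UnitaryGroup

/-! ## §1 Two measure-theoretic lemmas: a measure carried by a leaf, product positivity -/

section Generic

/-- A measure carried by `Z` sees a set through its trace on `Z`: `A ∩ Z ⊆ 𝒮 ⟹ Λ A ≤ Λ 𝒮`. [cite: Folland1995, §2.6 (2.52)] -/
theorem measure_le_of_inter_subset_of_compl_null {X : Type*} [MeasurableSpace X] (Λ : Measure X) {Z A 𝒮 : Set X} (hZ : MeasurableSet Z) (hΛZ : Λ Zᶜ = 0)
    (h : A ∩ Z ⊆ 𝒮) : Λ A ≤ Λ 𝒮 := by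
  rw [← measure_inter_add_sdiff A hZ]
  have h2 : Λ (A \ Z) = 0 := measure_mono_null (fun z hz => hz.2) hΛZ
  rw [h2, add_zero]
  exact measure_mono h

/-- **PRODUCT POSITIVITY**: an integrand on a finite product bounded by `M` and vanishing as soon as one coordinate leaves `A_i` has
`‖∫ F d(⊗_i μ_i)‖ ≤ M · Π_i μ_i(A_i)` (`Measure.pi_pi`). [cite: Folland1995, §2.6 (2.52)] -/
theorem norm_integral_pi_le_mul_prod_measure {ι : Type*} [Fintype ι] {X : ι → Type*} [∀ i, MeasurableSpace (X i)] (μ : ∀ i, Measure (X i))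
    [∀ i, SigmaFinite (μ i)] {E : Type*} [NormedAddCommGroup E] [NormedSpace ℝ E] (F : (∀ i, X i) → E) (A : ∀ i, Set (X i))
    (hA : ∀ i, MeasurableSet (A i)) (hfin : ∀ i, μ i (A i) < ⊤) {M : ℝ} (hM : ∀ x, ‖F x‖ ≤ M) (hvan : ∀ x, (∃ i, x i ∉ A i) → F x = 0) :
    ‖∫ x, F x ∂Measure.pi μ‖ ≤ M * ∏ i, (μ i (A i)).toReal := by
  have hbox_meas : MeasurableSet (Set.pi univ A) := MeasurableSet.univ_pi hA
  have hbox : (Measure.pi μ) (Set.pi univ A) = ∏ i, μ i (A i) := Measure.pi_pi μ A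
  have hbox_fin : (Measure.pi μ) (Set.pi univ A) < ⊤ := by
    rw [hbox]
    exact ENNReal.prod_lt_top fun i _ => hfin i
  have hΨ : ∀ x, ‖F x‖ ≤ (Set.pi univ A).indicator (fun _ => M) x := by
    intro x
    by_cases hx : x ∈ Set.pi univ A
    · rw [indicator_of_mem hx]
      exact hM x
    · rw [indicator_of_notMem hx]
      have hx' : ∃ i, x i ∉ A i := by
        by_contra h
        push Not at h
        exact hx fun i _ => h i
      rw [hvan x hx', norm_zero]
  refine (norm_integral_le_of_norm_le ((integrable_indicator_iff hbox_meas).2 (integrableOn_const hbox_fin.ne)) (Eventually.of_forall hΨ)).trans ?_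
  rw [integral_indicator_const M hbox_meas, measureReal_def, hbox, ENNReal.toReal_prod, smul_eq_mul, mul_comm]

end Generic

/-! ## §2 The assembly over the places -/

section Product

variable (L : Type) [Field L] [NumberField L] [IsCMField L] (S : Finset {w : InfinitePlace L // IsComplex w})
  [MeasurableSpace 𝔸[L]] [BorelSpace 𝔸[L]] [MeasurableSpace 𝔹[L]] [BorelSpace 𝔹[L]]
  (νH : Measure (𝔸[L] × 𝔹[L])) [νH.IsHaarMeasure] [νH.IsMulRightInvariant]

set_option maxHeartbeats 400000 in
/-- **THE NORMALISED CHART ORBITAL INTEGRAL IS LOCALLY BOUNDED UP TO ALL THE WALLS** (Harish-Chandra's estimate `|D(γ)|^{1/2} |O_γ(f)| ≤ B` near every point of the Cartan, compact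
walls included): for continuous compactly supported `fH`, a Haar measure `νH` and every `c₀` there are `U ∈ 𝓝 c₀` and `B` with `‖archRH S c · chartOrbH L νH S fH c‖ ≤ B` for all
`c ∈ U ∩ RegS S`.  Product positivity over ★ (α1): `‖K₀ E_S(c) ∫ fH … d(⊗_w Λ_w)‖ ≤ |K₀| · ‖fH‖_∞ · Π_w ‖E_w(c_w)‖ · Λ_w(A_w(c))`, each factor bounded near `c₀` — by uniform
properness off the walls, by ★ part 1 at the wall places of `c₀`. [cite: Varadarajan1989, §6.4 Lemma 21, Thm 22] [cite: Bouaziz1994IntegralesOrbitales, §3.1 (I₂) p. 579]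
[cite: Shelstad1979, §4 p. 24] [cite: Folland1995, §2.6 (2.52)] -/
theorem exists_nhds_norm_archRH_mul_chartOrbH_le (fH : 𝔸[L] × 𝔹[L] → ℂ) (hf : Continuous fH) (hfc : HasCompactSupport fH)
    (c₀ : {w : InfinitePlace L // IsComplex w} → Fin 3 → ℝ) :
    ∃ U ∈ 𝓝 c₀, ∃ B : ℝ, ∀ c ∈ U, c ∈ RegS S → ‖archRH S c * chartOrbH L νH S fH c‖ ≤ B := by
  -- Borel structures and instances at the places
  letI : ∀ w : {w : InfinitePlace L // IsComplex w}, MeasurableSpace ↥(archLocal L 2 Φ₂[L] w) := fun w => borel _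
  haveI : ∀ w : {w : InfinitePlace L // IsComplex w}, BorelSpace ↥(archLocal L 2 Φ₂[L] w) := fun w => ⟨rfl⟩
  haveI : ∀ w : {w : InfinitePlace L // IsComplex w}, LocallyCompactSpace ↥(archLocal L 2 Φ₂[L] w) := fun w => locallyCompactSpace_archLocal_two L w
  haveI : ∀ w : {w : InfinitePlace L // IsComplex w}, SecondCountableTopology ↥(archLocal L 2 Φ₂[L] w) := fun w => secondCountableTopology_archLocal_two L w
  -- (α1): the per-place leaves
  obtain ⟨νw, hνH', hνR, K₀, Λw, Zw, hΛfin, hZcl, hZnull, hexpl, hprop, hid⟩ := exists_placeLeaves_archRH_mul_chartOrbH_eq_of_isHaarMeasure L S νH fH hf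
  haveI : ∀ w, (νw w).IsHaarMeasure := hνH'
  haveI : ∀ w, (νw w).IsMulRightInvariant := hνR
  haveI : ∀ w, IsFiniteMeasureOnCompacts (Λw w) := hΛfin
  haveI : ∀ w, SigmaFinite (Λw w) := fun w => inferInstance
  -- the sup norm of `fH` and the shadows `C_w` of its support
  obtain ⟨M, hM⟩ := hfc.exists_bound_of_continuous hf
  have hM0 : 0 ≤ M := (norm_nonneg _).trans (hM 1)
  have hK : IsCompact (tsupport fH) := hfc
  obtain ⟨Cw, hCw_def⟩ : ∃ Cw : ∀ w : {w : InfinitePlace L // IsComplex w}, Set ↥(archLocal L 2 Φ₂[L] w),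
      Cw = fun w => (fun a : 𝔸[L] => archPiEquivCM 2 L Φ₂[L] a w) '' (Prod.fst '' tsupport fH) := ⟨_, rfl⟩
  have hCw : ∀ w, IsCompact (Cw w) := fun w => by
    rw [hCw_def]
    exact (hK.image continuous_fst).image ((continuous_apply w).comp (archPiEquivCM 2 L Φ₂[L]).continuous)
  have hvan : ∀ (G : ∀ w : {w : InfinitePlace L // IsComplex w}, ↥(archLocal L 2 Φ₂[L] w)) (y : 𝔹[L]), (∃ w, G w ∉ Cw w) →
      fH ((archPiEquivCM 2 L Φ₂[L]).symm G, y) = 0 := by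
    rintro G y ⟨w, hw⟩
    by_contra h
    rw [hCw_def] at hw
    refine hw ⟨(archPiEquivCM 2 L Φ₂[L]).symm G, ⟨((archPiEquivCM 2 L Φ₂[L]).symm G, y), subset_tsupport _ h, rfl⟩, ?_⟩
    show archPiEquivCM 2 L Φ₂[L] ((archPiEquivCM 2 L Φ₂[L]).symm G) w = G w
    rw [ContinuousMulEquiv.apply_symm_apply]
  -- the per-place conjugating maps and factors
  have hm_c : ∀ (w : {w : InfinitePlace L // IsComplex w}) (c : {w : InfinitePlace L // IsComplex w} → Fin 3 → ℝ),
      Continuous fun z : ↥(archLocal L 2 Φ₂[L] w) × ↥(archLocal L 2 Φ₂[L] w) => z.1 * (endoBlockAt L S w (c w) * z.2) * z.1⁻¹ :=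
    fun w c => (continuous_fst.mul (continuous_const.mul continuous_snd)).mul continuous_fst.inv
  have hA_meas : ∀ (w : {w : InfinitePlace L // IsComplex w}) (c : {w : InfinitePlace L // IsComplex w} → Fin 3 → ℝ),
      MeasurableSet {z : ↥(archLocal L 2 Φ₂[L] w) × ↥(archLocal L 2 Φ₂[L] w) | z.1 * (endoBlockAt L S w (c w) * z.2) * z.1⁻¹ ∈ Cw w} :=
    fun w c => ((hCw w).isClosed.preimage (hm_c w c)).measurableSet
  obtain ⟨Ew, hEw_def⟩ : ∃ Ew : ({w : InfinitePlace L // IsComplex w} → Fin 3 → ℝ) → {w : InfinitePlace L // IsComplex w} → ℂ,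
      Ew = fun c w => if w ∈ S then ((Real.exp (c w 0) : ℝ) : ℂ) else 1 - (Circle.exp (c w 2 - c w 0) : ℂ) := ⟨_, rfl⟩
  -- PER-PLACE WEIGHTED BOUNDS near `c₀`
  have hplace : ∀ w : {w : InfinitePlace L // IsComplex w}, ∃ U ∈ 𝓝 c₀, ∃ Bw : ℝ, ∀ c ∈ U, (w ∉ S → Circle.exp (c w 0) ≠ Circle.exp (c w 2)) →
      Λw w {z | z.1 * (endoBlockAt L S w (c w) * z.2) * z.1⁻¹ ∈ Cw w} < ⊤ ∧
        ‖Ew c w‖ * (Λw w {z | z.1 * (endoBlockAt L S w (c w) * z.2) * z.1⁻¹ ∈ Cw w}).toReal ≤ Bw := by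
    intro w
    by_cases hwall : w ∉ S ∧ Circle.exp (c₀ w 0) = Circle.exp (c₀ w 2)
    · -- A WALL PLACE OF `c₀`: the explicit leaf `(g ↦ (g,1))_* ν_w` and the wall place in coordinates
      obtain ⟨hwS, h0⟩ := hwall
      obtain ⟨U, hU, B, hB⟩ := exists_nhds_norm_mul_measure_conj_endoBlock_mem_le L S w (νw w) hwS (Cw w) (hCw w) c₀ h0
      refine ⟨U, hU, B, fun c hcU hreg => ?_⟩
      have hι : Measurable fun g : ↥(archLocal L 2 Φ₂[L] w) => (g, (1 : ↥(archLocal L 2 Φ₂[L] w))) := measurable_id.prodMk measurable_const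
      have hleaf : Λw w {z | z.1 * (endoBlockAt L S w (c w) * z.2) * z.1⁻¹ ∈ Cw w} = νw w {g : ↥(archLocal L 2 Φ₂[L] w) | g * endoBlock L S c w * g⁻¹ ∈ Cw w} := by
        rw [hexpl w hwS, Measure.map_apply hι (hA_meas w c)]
        congr 1
        ext g
        simp only [mem_preimage, mem_setOf_eq, mul_one, endoBlock_eq_endoBlockAt]
      have hE : Ew c w = 1 - (Circle.exp (c w 2 - c w 0) : ℂ) := by rw [hEw_def]; exact if_neg hwS
      rw [hleaf, hE]
      exact hB c hcU (hreg hwS)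
    · -- NOT A WALL PLACE: uniform properness of the leaf over a compact neighbourhood regular at `w`
      have hreg₀ : w ∉ S → Circle.exp (c₀ w 0) ≠ Circle.exp (c₀ w 2) := fun hw h => hwall ⟨hw, h⟩
      have hO : IsOpen {c : {w : InfinitePlace L // IsComplex w} → Fin 3 → ℝ | w ∉ S → Circle.exp (c w 0) ≠ Circle.exp (c w 2)} := by
        by_cases hw : w ∈ S
        · have : {c : {w : InfinitePlace L // IsComplex w} → Fin 3 → ℝ | w ∉ S → Circle.exp (c w 0) ≠ Circle.exp (c w 2)} = univ :=
            eq_univ_of_forall fun c h => absurd hw h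
          rw [this]; exact isOpen_univ
        · have : {c : {w : InfinitePlace L // IsComplex w} → Fin 3 → ℝ | w ∉ S → Circle.exp (c w 0) ≠ Circle.exp (c w 2)} =
              {c | Circle.exp (c w 0) ≠ Circle.exp (c w 2)} := Set.ext fun c => ⟨fun h => h hw, fun h _ => h⟩
          rw [this]
          exact isOpen_ne_fun (Circle.exp.continuous.comp (by fun_prop : Continuous fun c : {w : InfinitePlace L // IsComplex w} → Fin 3 → ℝ => c w 0))
            (Circle.exp.continuous.comp (by fun_prop : Continuous fun c : {w : InfinitePlace L // IsComplex w} → Fin 3 → ℝ => c w 2))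
      obtain ⟨U, hU, hUO, hUc⟩ := local_compact_nhds (hO.mem_nhds hreg₀)
      obtain ⟨𝒮, h𝒮c, h𝒮⟩ := hprop w U hUc (fun hw c hc => hUO hc hw) (Cw w) (hCw w)
      have hEc : Continuous fun c : {w : InfinitePlace L // IsComplex w} → Fin 3 → ℝ => Ew c w := by
        rw [hEw_def]
        by_cases hw : w ∈ S
        · simp only [if_pos hw]
          exact continuous_ofReal.comp (Real.continuous_exp.comp (by fun_prop : Continuous fun c : {w : InfinitePlace L // IsComplex w} → Fin 3 → ℝ => c w 0))
        · simp only [if_neg hw]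
          exact continuous_const.sub (continuous_subtype_val.comp (Circle.exp.continuous.comp
            (by fun_prop : Continuous fun c : {w : InfinitePlace L // IsComplex w} → Fin 3 → ℝ => c w 2 - c w 0)))
      obtain ⟨R, hR⟩ := hUc.exists_bound_of_continuousOn hEc.continuousOn
      refine ⟨U, hU, R * (Λw w 𝒮).toReal, fun c hcU _ => ?_⟩
      have hsub : Λw w {z | z.1 * (endoBlockAt L S w (c w) * z.2) * z.1⁻¹ ∈ Cw w} ≤ Λw w 𝒮 :=
        measure_le_of_inter_subset_of_compl_null (Λw w) (hZcl w).measurableSet (hZnull w) fun z hz => h𝒮 z hz.2 c hcU hz.1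
      have hR0 : 0 ≤ R := (norm_nonneg _).trans (hR c₀ (mem_of_mem_nhds hU))
      exact ⟨hsub.trans_lt h𝒮c.measure_lt_top, mul_le_mul (hR c hcU) (ENNReal.toReal_mono h𝒮c.measure_lt_top.ne hsub) ENNReal.toReal_nonneg hR0⟩
  -- ASSEMBLY over the places
  choose U hU Bw hB using hplace
  refine ⟨⋂ w, U w, (Filter.iInter_mem).2 hU, |K₀| * M * ∏ w, Bw w, fun c hcU hc => ?_⟩
  have hcw : ∀ w, c ∈ U w := fun w => mem_iInter.1 hcU w
  have hreg : ∀ w, w ∉ S → Circle.exp (c w 0) ≠ Circle.exp (c w 2) := ((mem_regS_iff S c).1 hc).1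
  have hint : ‖∫ z, fH ((archPiEquivCM 2 L Φ₂[L]).symm (fun w => (z w).1 * (endoBlockAt L S w (c w) * (z w).2) * (z w).1⁻¹), (endoTorus L S c).2)
      ∂(Measure.pi Λw)‖ ≤ M * ∏ w, (Λw w {z | z.1 * (endoBlockAt L S w (c w) * z.2) * z.1⁻¹ ∈ Cw w}).toReal :=
    norm_integral_pi_le_mul_prod_measure Λw _ (fun w => {z | z.1 * (endoBlockAt L S w (c w) * z.2) * z.1⁻¹ ∈ Cw w}) (fun w => hA_meas w c)
      (fun w => (hB w c (hcw w) (hreg w)).1) (fun z => hM _) (fun z hz => hvan _ _ hz)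
  have hEprod : (∏ w, (if w ∈ S then ((Real.exp (c w 0) : ℝ) : ℂ) else 1 - (Circle.exp (c w 2 - c w 0) : ℂ))) = ∏ w, Ew c w := by rw [hEw_def]
  rw [hid c hc, hEprod]
  calc ‖(K₀ : ℂ) * (∏ w, Ew c w) * ∫ z, fH ((archPiEquivCM 2 L Φ₂[L]).symm (fun w => (z w).1 * (endoBlockAt L S w (c w) * (z w).2) * (z w).1⁻¹),
          (endoTorus L S c).2) ∂(Measure.pi Λw)‖
      = |K₀| * (∏ w, ‖Ew c w‖) * ‖∫ z, fH ((archPiEquivCM 2 L Φ₂[L]).symm (fun w => (z w).1 * (endoBlockAt L S w (c w) * (z w).2) * (z w).1⁻¹),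
          (endoTorus L S c).2) ∂(Measure.pi Λw)‖ := by rw [norm_mul, norm_mul, Complex.norm_real, Real.norm_eq_abs, norm_prod]
    _ ≤ |K₀| * (∏ w, ‖Ew c w‖) * (M * ∏ w, (Λw w {z | z.1 * (endoBlockAt L S w (c w) * z.2) * z.1⁻¹ ∈ Cw w}).toReal) :=
        mul_le_mul_of_nonneg_left hint (mul_nonneg (abs_nonneg _) (Finset.prod_nonneg fun w _ => norm_nonneg _))
    _ = |K₀| * M * ∏ w, (‖Ew c w‖ * (Λw w {z | z.1 * (endoBlockAt L S w (c w) * z.2) * z.1⁻¹ ∈ Cw w}).toReal) := by rw [Finset.prod_mul_distrib]; ring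
    _ ≤ |K₀| * M * ∏ w, Bw w :=
        mul_le_mul_of_nonneg_left (Finset.prod_le_prod (fun w _ => mul_nonneg (norm_nonneg _) ENNReal.toReal_nonneg) fun w _ => (hB w c (hcw w) (hreg w)).2)
          (mul_nonneg (abs_nonneg _) hM0)

end Product

end Literature.NumberTheory.Automorphic.UnitaryGroup

end
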